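import Summits.FinalStateConjecture.FinalStateConjecture.Theorems.PhotonSphereChannelsChannelsResolveTameDevelopmentsRHullKretschmann
import Summits.FinalStateConjecture.FinalStateConjecture.Theorems.PhotonSphereChannelsChannelsResolveTameDevelopmentsRKerrDocCurvature
import Summits.FinalStateConjecture.FinalStateConjecture.Theorems.PhotonSphereChannelsChannelsResolveTameDevelopmentsRKretschmannContinuity
import HarnessLib

/-!
# Route PhotonSphereChannels · crux `ChannelsResolveTameDevelopmentsR` (K2R-T2, stmt-FinalStateConjecture-17430) —
# curvature at the BASE POINT of a hull element: limits based at uniformly curved points are not flat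

Sequel of `…RHullKretschmann.lean` (`tendsto_kretschmannAt`: the Kretschmann scalar is continuous under
pointed `C²` convergence). The comparison maps send the limit's base point to the approximants' base
points (`embed_basepoint`), so the Kretschmann scalar AT THE BASE POINT of a pointed `C²` limit is the
limit of the scalars at the base points of the approximants (`tendsto_kretschmannAt_basepoint`); lower /
upper bounds pass to the limit. A Minkowski space (`TameHull.IsMinkowski`: a smooth bijective exactly flat
time-oriented chart of `ℝ⁴`) is Kretschmann-flat (`kretschmannAt_eq_zero_of_isMinkowski`). Hence the
closedness half of the line's clopen step in quantitative form (`dark-future-exactness`, stub K's "base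
points on the horizon forbid degeneration to flat"): **a hull element of ANY development based at points
where `|Rm|² ≥ κ > 0` eventually has a limit with `|Rm|²(p) ≥ κ`, in particular it is NOT Minkowski**
(`not_isMinkowski_of_isHullElement_of_le_kretschmannAt`), and dually `|Rm|² ≤ −κ < 0`.

All results proved; no definitions.

## References

* P. Petersen, *Riemannian Geometry*, 2nd ed. (2006), Ch. 10, §3.2. [Petersen2006]
* B. O'Neill, *Semi-Riemannian geometry* (1983), Ch. 3, Prop. 3.41, Prop. 3.59. [ONeill1983]
-/

noncomputable section

set_option maxSynthPendingDepth 3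
set_option linter.dupNamespace false

open Set Filter Function TopologicalSpace Metric
open scoped Topology Manifold ContDiff ENNReal NNReal

namespace Summit.FinalStateConjecture.FinalStateConjecture.Theorems.HullCurvature

open Literature.Geometry.Lorentzian
open Summit.FinalStateConjecture.FinalStateConjecture.Theorems.TameHull

/-! ## §1 The Kretschmann scalar at the base point of a pointed limit -/

/-- **At the base point**: `|Rm|²_{𝓢_{sub n}}(p_{sub n}) → |Rm|²_𝓢(p)` (`tendsto_kretschmannAt` at `x = p`,
`φₙ p = p_{sub n}`). [cite: Petersen2006, Ch. 10 §3.2] -/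
theorem tendsto_kretschmannAt_basepoint {𝓢ₙ : ℕ → Spacetime.{0} 4} {pₙ : ∀ n, (𝓢ₙ n).carrier}
    {𝓢 : Spacetime.{0} 4} {p : 𝓢.carrier} {k : ℕ} (D : Spacetime.LocalSubconvergence 𝓢ₙ pₙ 𝓢 p k)
    (hk : 2 ≤ k) :
    Tendsto (fun n ↦ (𝓢ₙ (D.sub n)).kretschmannAt (pₙ (D.sub n))) atTop (𝓝 (𝓢.kretschmannAt p)) := by
  have h := tendsto_kretschmannAt D hk p
  refine h.congr fun n ↦ ?_
  rw [D.embed_basepoint n]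

/-- **Lower bounds at the base points pass to the limit**: if `(𝓢ₙ, pₙ) ⇀ (𝓢, p)` in pointed `Cᵏ`,
`k ≥ 2`, and eventually `κ ≤ |Rm|²_{𝓢ₙ}(pₙ)`, then `κ ≤ |Rm|²_𝓢(p)`. [cite: Petersen2006, Ch. 10 §3.2] -/
theorem le_kretschmannAt_of_subconvergesLocallyTo {𝓢ₙ : ℕ → Spacetime.{0} 4} {pₙ : ∀ n, (𝓢ₙ n).carrier}
    {𝓢 : Spacetime.{0} 4} {p : 𝓢.carrier} {k : ℕ} (h : Spacetime.SubconvergesLocallyTo 𝓢ₙ pₙ 𝓢 p k)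
    (hk : 2 ≤ k) {κ : ℝ} (hκ : ∀ᶠ n in atTop, κ ≤ (𝓢ₙ n).kretschmannAt (pₙ n)) :
    κ ≤ 𝓢.kretschmannAt p := by
  obtain ⟨D⟩ := h
  have hsub : Tendsto D.sub atTop atTop := D.strictMono_sub.tendsto_atTop
  exact ge_of_tendsto (tendsto_kretschmannAt_basepoint D hk) (hsub.eventually hκ)

/-- **Upper bounds at the base points pass to the limit.** [cite: Petersen2006, Ch. 10 §3.2] -/
theorem kretschmannAt_le_of_subconvergesLocallyTo {𝓢ₙ : ℕ → Spacetime.{0} 4} {pₙ : ∀ n, (𝓢ₙ n).carrier}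
    {𝓢 : Spacetime.{0} 4} {p : 𝓢.carrier} {k : ℕ} (h : Spacetime.SubconvergesLocallyTo 𝓢ₙ pₙ 𝓢 p k)
    (hk : 2 ≤ k) {κ : ℝ} (hκ : ∀ᶠ n in atTop, (𝓢ₙ n).kretschmannAt (pₙ n) ≤ κ) :
    𝓢.kretschmannAt p ≤ κ := by
  obtain ⟨D⟩ := h
  have hsub : Tendsto D.sub atTop atTop := D.strictMono_sub.tendsto_atTop
  exact le_of_tendsto (tendsto_kretschmannAt_basepoint D hk) (hsub.eventually hκ)

/-! ## §2 Minkowski spaces are Kretschmann-flat -/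

/-- **A Minkowski space is Kretschmann-flat**: the chart `Ψ : ℝ⁴ → 𝓢` of `IsMinkowski 𝓢` is an isometric
immersion of Minkowski spacetime (`Ψ^* g = η`) onto `𝓢`, along which the Kretschmann scalars agree
(`kretschmannAt_comp_of_isIsometricImmersion`), and Minkowski's vanishes. [cite: ONeill1983, Ch. 3, Prop. 3.41] -/
theorem kretschmannAt_eq_zero_of_isMinkowski {𝓢 : Spacetime.{0} 4} (h : IsMinkowski 𝓢) (x : 𝓢.carrier) :
    𝓢.kretschmannAt x = 0 := by
  obtain ⟨Ψ, hbij, hsmooth, hdev, -⟩ := h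
  have hE : Minkowski.spacetime.metric.IsIsometricImmersion 𝓢.metric.toPseudoRiemannianMetric Ψ := by
    refine ⟨hsmooth, fun y ↦ ?_⟩
    have h := hdev y
    rw [Spacetime.minkowskiDeviation, sub_eq_zero] at h
    exact h
  obtain ⟨y, rfl⟩ := hbij.2 x
  rw [Spacetime.kretschmannAt_comp_of_isIsometricImmersion (𝓢 := 𝓢) (𝓤 := Minkowski.spacetime) hE y]
  exact Minkowski.kretschmannAt_spacetime y

/-- **A spacetime with a point of nonzero Kretschmann scalar is not a Minkowski space.**
[cite: ONeill1983, Ch. 3, Prop. 3.41] -/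
theorem not_isMinkowski_of_kretschmannAt_ne_zero {𝓢 : Spacetime.{0} 4} {x : 𝓢.carrier}
    (hx : 𝓢.kretschmannAt x ≠ 0) : ¬ IsMinkowski 𝓢 :=
  fun h ↦ hx (kretschmannAt_eq_zero_of_isMinkowski h x)

/-! ## §3 Hull elements based at uniformly curved points are not Minkowski -/

section Hull

variable {X : Type} [TopologicalSpace X] [ChartedSpace E3 X] [IsManifold (𝓡 3) ∞ X]
  [T2Space X] [SecondCountableTopology X] [ConnectedSpace X] {D : InitialDataSet (𝓡 3) X}

omit [T2Space X] [SecondCountableTopology X] in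
/-- **No degeneration to flat at curved base points.** If `(q, 𝓢, E, p)` is a hull element of a
development `𝒟` (any class) whose base points eventually have `|Rm|²_𝒟(qₙ) ≥ κ` with `κ > 0`, then the
limit has `|Rm|²_𝓢(p) ≥ κ` and `𝓢` is NOT a Minkowski space — the quantitative form of "base points on the
horizon forbid degeneration to flat" (line `dark-future-exactness`, stub K), for base sequences along
which the development's Kretschmann scalar stays away from `0` (e.g. near a Kerr horizon, where
`|Rm|² ≈ ¾M⁻⁴`). [cite: Petersen2006, Ch. 10 §3.2] -/
theorem not_isMinkowski_of_isHullElement_of_le_kretschmannAt {𝒟 : VacuumCauchyDevelopment D}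
    [𝒟.metric.HasLeviCivita] {Λ : ℝ≥0} {r₀ : ℝ} {q : ℕ → 𝒟.carrier} {𝓢 : Spacetime.{0} 4}
    {E : EndDatum 𝓢} {p : 𝓢.carrier} (hZ : IsHullElement 𝒟 Λ r₀ q 𝓢 E p) {κ : ℝ} (hκ : 0 < κ)
    (hq : ∀ᶠ n in atTop, κ ≤ 𝒟.toSpacetime.kretschmannAt (q n)) :
    κ ≤ 𝓢.kretschmannAt p ∧ ¬ IsMinkowski 𝓢 := by
  have hle : κ ≤ 𝓢.kretschmannAt p := le_kretschmannAt_of_subconvergesLocallyTo hZ.subconverges le_rfl hq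
  exact ⟨hle, not_isMinkowski_of_kretschmannAt_ne_zero (x := p) (by linarith)⟩

omit [T2Space X] [SecondCountableTopology X] in
/-- The same with NEGATIVE curvature scalar (`|Rm|² ≤ −κ < 0` eventually at the base points; the
Kretschmann scalar of a Lorentzian metric has no sign). [cite: Petersen2006, Ch. 10 §3.2] -/
theorem not_isMinkowski_of_isHullElement_of_kretschmannAt_le {𝒟 : VacuumCauchyDevelopment D}
    [𝒟.metric.HasLeviCivita] {Λ : ℝ≥0} {r₀ : ℝ} {q : ℕ → 𝒟.carrier} {𝓢 : Spacetime.{0} 4}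
    {E : EndDatum 𝓢} {p : 𝓢.carrier} (hZ : IsHullElement 𝒟 Λ r₀ q 𝓢 E p) {κ : ℝ} (hκ : 0 < κ)
    (hq : ∀ᶠ n in atTop, 𝒟.toSpacetime.kretschmannAt (q n) ≤ -κ) :
    𝓢.kretschmannAt p ≤ -κ ∧ ¬ IsMinkowski 𝓢 := by
  have hle : 𝓢.kretschmannAt p ≤ -κ := kretschmannAt_le_of_subconvergesLocallyTo hZ.subconverges le_rfl hq
  exact ⟨hle, not_isMinkowski_of_kretschmannAt_ne_zero (x := p) (by linarith)⟩

omit [T2Space X] [SecondCountableTopology X] in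
/-- **Mass bound for Schwarzschild elements based in the closed d.o.c.** If `(q, 𝓢, E, p)` is a hull
element of a development whose base points eventually have `|Rm|²_𝒟(qₙ) ≥ κ > 0`, the base point `p` lies
in `closure E.doc` (e.g. `p ∈ E.horizon`, `horizon_subset_closure_doc`), and `E.doc` is an exact
SCHWARZSCHILD d.o.c. of mass `M > 0` (`IsKerrDoc 𝓢 E.doc M 0`), then `M⁴ ≤ ¾ κ⁻¹`: the limit inherits
`|Rm|²(p) ≥ κ` (`le_kretschmannAt_of_subconvergesLocallyTo`), while `|Rm|² < ¾M⁻⁴` on the doc passes to its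
closure (`kretschmannAt_le_of_mem_closure`, `kretschmannAt_pos_lt_of_isKerrDoc_schwarzschild`). The masses
of Schwarzschild horizon-hull elements along a generator are bounded by the development's horizon
curvature — one of the two inequalities of the PINNING step of stub K. [cite: Petersen2006, Ch. 10 §3.2] -/
theorem mass_pow_four_le_of_isHullElement_schwarzschildDoc {𝒟 : VacuumCauchyDevelopment D}
    [𝒟.metric.HasLeviCivita] {Λ : ℝ≥0} {r₀ : ℝ} {q : ℕ → 𝒟.carrier} {𝓢 : Spacetime.{0} 4}
    {E : EndDatum 𝓢} {p : 𝓢.carrier} (hZ : IsHullElement 𝒟 Λ r₀ q 𝓢 E p) (hp : p ∈ closure E.doc)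
    {M : ℝ} (hM : 0 < M) (hK : IsKerrDoc 𝓢 E.doc M 0) {κ : ℝ} (hκ : 0 < κ)
    (hq : ∀ᶠ n in atTop, κ ≤ 𝒟.toSpacetime.kretschmannAt (q n)) : M ^ 4 ≤ 3 / (4 * κ) := by
  have hlow : κ ≤ 𝓢.kretschmannAt p := le_kretschmannAt_of_subconvergesLocallyTo hZ.subconverges le_rfl hq
  have hup : 𝓢.kretschmannAt p ≤ 3 / (4 * M ^ 4) :=
    kretschmannAt_le_of_mem_closure
      (fun y hy ↦ (kretschmannAt_pos_lt_of_isKerrDoc_schwarzschild hK hM hy).2.le) hp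
  have h1 : κ ≤ 3 / (4 * M ^ 4) := hlow.trans hup
  rw [le_div_iff₀ (by positivity)] at h1
  rw [le_div_iff₀ (by positivity)]
  nlinarith

omit [T2Space X] [SecondCountableTopology X] in
/-- The same for a HORIZON-hull base point `p ∈ E.horizon`. [cite: Petersen2006, Ch. 10 §3.2] -/
theorem mass_pow_four_le_of_isHullElement_horizon_schwarzschildDoc {𝒟 : VacuumCauchyDevelopment D}
    [𝒟.metric.HasLeviCivita] {Λ : ℝ≥0} {r₀ : ℝ} {q : ℕ → 𝒟.carrier} {𝓢 : Spacetime.{0} 4}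
    {E : EndDatum 𝓢} {p : 𝓢.carrier} (hZ : IsHullElement 𝒟 Λ r₀ q 𝓢 E p) (hp : p ∈ E.horizon)
    {M : ℝ} (hM : 0 < M) (hK : IsKerrDoc 𝓢 E.doc M 0) {κ : ℝ} (hκ : 0 < κ)
    (hq : ∀ᶠ n in atTop, κ ≤ 𝒟.toSpacetime.kretschmannAt (q n)) : M ^ 4 ≤ 3 / (4 * κ) :=
  mass_pow_four_le_of_isHullElement_schwarzschildDoc hZ (horizon_subset_closure_doc E hp) hM hK hκ hq

end Hull

/-- **Summary (registered sub-goal).** For every pointed `C²` convergence datum the base-point Kretschmann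
scalars converge, and a Minkowski space is Kretschmann-flat; so a hull element of any development based at
points with `|Rm|² ≥ κ > 0` eventually is not Minkowski. [cite: Petersen2006, Ch. 10 §3.2] -/
theorem hull_basepoint_curvature_summary : (∀ {𝓢ₙ : ℕ → Spacetime.{0} 4} {pₙ : ∀ n, (𝓢ₙ n).carrier} {𝓢 : Spacetime.{0} 4} {p : 𝓢.carrier} {k : ℕ} (D : Spacetime.LocalSubconvergence 𝓢ₙ pₙ 𝓢 p k), 2 ≤ k → Tendsto (fun n ↦ (𝓢ₙ (D.sub n)).kretschmannAt (pₙ (D.sub n))) atTop (𝓝 (𝓢.kretschmannAt p))) ∧ (∀ {𝓢 : Spacetime.{0} 4}, IsMinkowski 𝓢 → ∀ x : 𝓢.carrier, 𝓢.kretschmannAt x = 0) ∧ ∀ {X : Type} [TopologicalSpace X] [ChartedSpace E3 X] [IsManifold (𝓡 3) ∞ X] [ConnectedSpace X] {D : InitialDataSet (𝓡 3) X} {𝒟 : VacuumCauchyDevelopment D} [𝒟.metric.HasLeviCivita] {Λ : ℝ≥0} {r₀ : ℝ} {q : ℕ → 𝒟.carrier} {𝓢 : Spacetime.{0} 4} {E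 : EndDatum 𝓢} {p : 𝓢.carrier}, IsHullElement 𝒟 Λ r₀ q 𝓢 E p → ∀ κ : ℝ, 0 < κ → (∀ᶠ n in atTop, κ ≤ 𝒟.toSpacetime.kretschmannAt (q n)) → κ ≤ 𝓢.kretschmannAt p ∧ ¬ IsMinkowski 𝓢 :=
  ⟨fun D hk ↦ tendsto_kretschmannAt_basepoint D hk, fun h x ↦ kretschmannAt_eq_zero_of_isMinkowski h x,
    fun hZ _ hκ hq ↦ not_isMinkowski_of_isHullElement_of_le_kretschmannAt hZ hκ hq⟩

end Summit.FinalStateConjecture.FinalStateConjecture.Theorems.HullCurvature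

end
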